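import Mathlib
import HarnessLib
import Summits.NavierStokesRegularity.NavierStokesRegularity.Theorems.LocalSineTubeDoorSequentialDoor
import Summits.NavierStokesRegularity.NavierStokesRegularity.Theorems.LocalSineTubeDoorMostTimesFixedDirectionDoor

/-!
# The simplest instances of the one-slice door templates: the VORTICITY-WINDOW doors (unconditional)

Cell ns-regularity-ideate, seat p6 (`--supports stmt-NavierStokesRegularity-20017`; rung N0-LocalTubeDoorSine neighbourhood).
With the first-order scalar `F(x, A) = ‖curlCLM A‖` (the vorticity magnitude) the one-slice crux is immediate: a Type-I
profile whose vorticity VANISHES on a nonempty open window of one slice is aligned there with any fixed `e ≠ 0`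
(`cross 0 e = 0`), hence `v ≡ 0` by `eq_zero_of_aligned_window` (item stmt-…-20018).  The templates
`…SequentialDoor.sequentialDoor_of_oneSliceWindowRigidity` and `…MostTimesFixedDirectionDoor.bandDoor_of_oneSliceWindowRigidity`
then give:

* `sequentialVorticityDoor` — classical Leray–Hopf from rapidly decaying data, LOCAL Type I at `(x₀,T)`, `U` nonempty open,
  `tₖ → T` in `[0,T)` with bounded gaps: `∫_U (T−tₖ) ‖curl u(tₖ, x₀ + √(T−tₖ)y)‖ dy → 0` ⇒ backward bounded at `x₀`;
* `mostTimesVorticityDoor` — the same with fading along all times outside an exceptional set of density → 0 at `T`.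

(The scale-normalised vorticity `(T−t)|ω|` fading in `L¹` on ONE similarity window along a sparse set of times already rules
out the singularity under local Type I.)

WHAT THIS IS NOT: not a claim about Navier–Stokes regularity (Clay A) — local, conditional-on-Type-I regularity CRITERIA;
establishment in the cell's sense needs the cross-family referee PASS + independent reproduction (bears_on LADDER-NS N0).
-/

noncomputable section

-- the summit and its single sub-problem share the name (CONVENTIONS §1), as in every Theorems file
set_option linter.dupNamespace false

namespace Summit.NavierStokesRegularity.NavierStokesRegularity.Theorems.LocalSineTubeDoorSequentialVorticityDoor

open MeasureTheory Set Function Filter Topology TopologicalSpace Metric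
open scoped RealInnerProductSpace InnerProductSpace NNReal ENNReal
open Literature.Analysis Literature.Analysis.FluidPDE
open Summit.NavierStokesRegularity.NavierStokesRegularity.Theorems.LocalSineTubeDoorProfileAlignedWindowRigidity
open Summit.NavierStokesRegularity.NavierStokesRegularity.Theorems.PoloidalWindowDoorPoloidalWindowRigidityFlat
open Summit.NavierStokesRegularity.NavierStokesRegularity.Theorems.LocalSineTubeDoorSequentialDoor
open Summit.NavierStokesRegularity.NavierStokesRegularity.Theorems.LocalSineTubeDoorMostTimesCrossDoor
open Summit.NavierStokesRegularity.NavierStokesRegularity.Theorems.LocalSineTubeDoorMostTimesFixedDirectionDoor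

/-- The vorticity-magnitude scalar `F(x, A) = ‖curlCLM A‖` is continuous in `(x, A)`. -/
theorem continuous_curlNorm :
    Continuous fun q : EuclideanSpace ℝ (Fin 3) × (EuclideanSpace ℝ (Fin 3) →L[ℝ] EuclideanSpace ℝ (Fin 3)) =>
      ‖curlCLM q.2‖ :=
  continuous_norm.comp (curlCLM.continuous.comp continuous_snd)

/-- The zero set of `F(x, A) = ‖curlCLM A‖` is invariant under positive rescalings. -/
theorem curlNorm_zeroSet_invariant :
    ∀ (a b : ℝ), 0 < a → 0 < b → ∀ (x : EuclideanSpace ℝ (Fin 3))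
      (A : EuclideanSpace ℝ (Fin 3) →L[ℝ] EuclideanSpace ℝ (Fin 3)), ‖curlCLM (b • A)‖ = 0 ↔ ‖curlCLM A‖ = 0 := by
  intro a b _ hb x A
  rw [map_smul, norm_smul, mul_eq_zero, Real.norm_eq_abs, abs_eq_zero, or_iff_right hb.ne']

/-- The one-slice profile crux for the vorticity magnitude: a profile of the Type-I class whose vorticity vanishes on a
nonempty open window of ONE slice is not backward-singular (`eq_zero_of_aligned_window` with any fixed direction). -/
theorem oneSliceCrux_curlNorm :
    ∀ (C : ℝ) (v : ℝ → EuclideanSpace ℝ (Fin 3) → EuclideanSpace ℝ (Fin 3)),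
      Literature.Analysis.FluidPDE.HasTypeITimeDecay C v →
      ContinuousOn (Function.uncurry v) (Set.Iio (0 : ℝ) ×ˢ Set.univ) →
      (∀ s t : ℝ, s < t → t < 0 → ∀ x, v t x =
        Literature.Analysis.UnboundedOperators.heatExtension (v s) (t - s) x -
          Literature.Analysis.FluidPDE.oseenDuhamel 1 s v v t x) →
      (∀ t < 0, Literature.Analysis.FluidPDE.VectorCalculus.IsDivFree (v t)) →
      (∃ s < 0, ∃ U : Set (EuclideanSpace ℝ (Fin 3)), IsOpen U ∧ U.Nonempty ∧
        ∀ z ∈ U, (fun (_ : EuclideanSpace ℝ (Fin 3)) (A : EuclideanSpace ℝ (Fin 3) →L[ℝ] EuclideanSpace ℝ (Fin 3)) =>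
          ‖curlCLM A‖) (v s z) (fderiv ℝ (v s) z) = 0) →
      ¬ Literature.Analysis.FluidPDE.IsBackwardSingularPoint v 0 := by
  intro C v hrate hcont hmild hdiv hwin
  obtain ⟨s, hs, U', hU', hne', hzero⟩ := hwin
  have he : (EuclideanSpace.single 0 1 : EuclideanSpace ℝ (Fin 3)) ≠ 0 := by
    intro h0
    have := congrArg (fun w : EuclideanSpace ℝ (Fin 3) => w 0) h0
    simp at this
  refine not_backwardSingular_of_zero (eq_zero_of_aligned_window hrate hcont hmild hdiv hs he hU' hne' ?_)
  intro z hz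
  have h := hzero z hz
  simp only [norm_eq_zero] at h
  rw [← curl_eq_curlCLM] at h
  rw [h, ← crossCLM_apply, map_zero, zero_apply]

/-- **THE SEQUENTIAL VORTICITY-WINDOW DOOR (unconditional).**  See the module docstring. -/
theorem sequentialVorticityDoor :
    ∀ (ν T : ℝ), 0 < ν → 0 < T → ∀ (u : ℝ → EuclideanSpace ℝ (Fin 3) → EuclideanSpace ℝ (Fin 3))
      (p : ℝ → EuclideanSpace ℝ (Fin 3) → ℝ),
    Literature.Analysis.FluidPDE.IsClassicalNSSolutionOn (Set.Ico 0 T) ν 0 u p →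
    Literature.Analysis.FluidPDE.IsLerayHopfOn T ν 0 (u 0) u →
    Literature.Analysis.FluidPDE.HasRapidSpatialDecay (u 0) →
    ∀ (x₀ : EuclideanSpace ℝ (Fin 3)) (ρ M : ℝ), 0 < ρ →
    (∀ t ∈ Set.Ico 0 T, T - ρ ^ 2 < t → ∀ x ∈ Metric.ball x₀ ρ, ‖u t x‖ * Real.sqrt (ν * (T - t)) ≤ M) →
    ∀ (U : Set (EuclideanSpace ℝ (Fin 3))), IsOpen U → U.Nonempty →
    ∀ (t : ℕ → ℝ) (c : ℝ), 0 < c → (∀ k, t k ∈ Set.Ico 0 T) → Filter.Tendsto t Filter.atTop (nhds T) →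
    (∀ k, c * (T - t k) ≤ T - t (k + 1)) →
    Filter.Tendsto (fun k => ∫⁻ y in U, ENNReal.ofReal
      ((T - t k) * ‖Literature.Analysis.FluidPDE.curl (u (t k)) (x₀ + Real.sqrt (T - t k) • y)‖)) Filter.atTop (nhds 0) →
    Literature.Analysis.FluidPDE.IsBackwardBoundedAt u T x₀ := by
  intro ν T hν hT u p hsol hLH hdec x₀ ρ M hρ hM U hU hUne t c hc htk htT hgap hfade
  refine sequentialDoor_of_oneSliceWindowRigidity (fun _ A => ‖curlCLM A‖) continuous_curlNorm curlNorm_zeroSet_invariant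
    oneSliceCrux_curlNorm ν T hν hT u p hsol hLH hdec x₀ ρ M hρ hM U hU hUne t c hc htk htT hgap ?_
  refine hfade.congr fun k => ?_
  refine lintegral_congr fun y => ?_
  have ht : 0 ≤ T - t k := (sub_pos.2 (htk k).2).le
  rw [map_smul, ← curl_eq_curlCLM, Real.sq_sqrt ht, norm_smul, Real.norm_eq_abs, abs_of_nonneg ht, abs_of_nonneg
    (mul_nonneg ht (norm_nonneg _))]

/-- **THE MOST-TIMES VORTICITY-WINDOW DOOR (unconditional).**  See the module docstring. -/
theorem mostTimesVorticityDoor :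
    ∀ (ν T : ℝ), 0 < ν → 0 < T → ∀ (u : ℝ → EuclideanSpace ℝ (Fin 3) → EuclideanSpace ℝ (Fin 3))
      (p : ℝ → EuclideanSpace ℝ (Fin 3) → ℝ),
    Literature.Analysis.FluidPDE.IsClassicalNSSolutionOn (Set.Ico 0 T) ν 0 u p →
    Literature.Analysis.FluidPDE.IsLerayHopfOn T ν 0 (u 0) u →
    Literature.Analysis.FluidPDE.HasRapidSpatialDecay (u 0) →
    ∀ (x₀ : EuclideanSpace ℝ (Fin 3)) (ρ M : ℝ), 0 < ρ →
    (∀ t ∈ Set.Ico 0 T, T - ρ ^ 2 < t → ∀ x ∈ Metric.ball x₀ ρ, ‖u t x‖ * Real.sqrt (ν * (T - t)) ≤ M) →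
    ∀ (U : Set (EuclideanSpace ℝ (Fin 3))), IsOpen U → U.Nonempty →
    ∀ (E : Set ℝ), (∀ ε > 0, ∀ᶠ h in nhdsWithin (0 : ℝ) (Set.Ioi 0),
      MeasureTheory.volume (E ∩ Set.Ioo (T - h) T) ≤ ENNReal.ofReal (ε * h)) →
    (∀ t : ℕ → ℝ, (∀ k, t k ∈ Set.Ico 0 T ∧ t k ∉ E) → Filter.Tendsto t Filter.atTop (nhds T) →
      Filter.Tendsto (fun k => ∫⁻ y in U, ENNReal.ofReal
        ((T - t k) * ‖Literature.Analysis.FluidPDE.curl (u (t k)) (x₀ + Real.sqrt (T - t k) • y)‖)) Filter.atTop (nhds 0)) →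
    Literature.Analysis.FluidPDE.IsBackwardBoundedAt u T x₀ := by
  intro ν T hν hT u p hsol hLH hdec x₀ ρ M hρ hM U hU hUne E hE hfadeE
  refine bandDoor_of_oneSliceWindowRigidity (fun _ A => ‖curlCLM A‖) continuous_curlNorm curlNorm_zeroSet_invariant
    oneSliceCrux_curlNorm ν T hν hT u p hsol hLH hdec x₀ ρ M hρ hM U hU hUne (fun t' => t' ∉ E) (1 / 2) (by norm_num)
    (band_of_densityZero hT hE) fun t htk htT => ?_
  refine (hfadeE t htk htT).congr fun k => ?_
  refine lintegral_congr fun y => ?_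
  have ht : 0 ≤ T - t k := (sub_pos.2 (htk k).1.2).le
  rw [map_smul, ← curl_eq_curlCLM, Real.sq_sqrt ht, norm_smul, Real.norm_eq_abs, abs_of_nonneg ht, abs_of_nonneg
    (mul_nonneg ht (norm_nonneg _))]

end Summit.NavierStokesRegularity.NavierStokesRegularity.Theorems.LocalSineTubeDoorSequentialVorticityDoor

end
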